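import Literature.Barriers.CriticalPhenomena.GridSAWSquaresEnumeration
import Literature.Barriers.CriticalPhenomena.GridSAWTowersPieceFn
import HarnessLib

/-!
# Squares step of Theorem 7 (4) (Liśkiewicz–Ogihara–Toda 2003), machine part: the GENERATOR of
# the code of `E₃ - σ` — the two piece functions as brick assemblies, and the clipped folds

Sibling of `GridSAWSquaresEnumeration.lean` (WHAT the generator emits: the flat pieces
`scaledPieceFlat k Λ D c i` of the scaled paths — family A, mixed radix `(e, q, t)` — and
`squarePieceFlat k β D c i` of the new edges of the squares — family B, mixed radix `(e, j, m)` —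
and `framesOf_squaresInstance`: the framed items of the code of `(squaresInstance P D s t).1` are
the family-A concatenation followed by the family-B concatenation), of `GridSAWSquaresShift.lean`
(the instance `squaresInstance`, `squaresBeta N = N² + 1`, `squaresK N = 2β + 3`, the string map
`squaresReduce` and the machine fact `LOT2003_thm7_anyLength_squares_FP`) and of
`GridSAWTowersPieceFn.lean`, the model of this file (the same service for the towered `E₂` of
Theorem 7 (1): the context `TowerGen.ctx w Λ v = ⟨w, ⟨1^Λ, ⟨dpEnc v.1, dpEnc v.2⟩⟩⟩`, the piece
argument `arg … i = ⟨ctx, 1ⁱ⟩`, the projections `wF`, `lamF`, `v1F`, `v2F`, `idxF`, the structural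
lemmas on the canonical codes `encDG_eq`, `encDE_eq`, `encPL_eq`, `nthItemFn_encList_map`, the
item coder `cV v` of a translated edge, and the size lemmas `length_encPt_le`,
`length_encPt_le_of_size`). This file builds HOW the two families are emitted, in the tree's `FP`
brick algebra, with no machine written:

* derived unary constants on the piece argument: `uNF = 1^N` (`N = |P|`, the header of the
  point-list code), `uBetaF = 1^β`, `uFacF = 1^k` (`uFacF_argOf`);
* **Stage A** (indices in unary by `Plumb.divModFn`/`HashBricks.umulFn`): family A
  `ueAF, uqAF, utAF` (radices `Λ k`, `k`: `idxAE`, `idxAQ`, `idxAT`, `scaledPieceFlat_eq`), family B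
  `ueBF, ujBF, umBF` (radices `β · 3`, `3`: `idxBE`, `idxBJ`, `idxBM`, `squarePieceFlat_eq`);
* **Stage B**, generic in the index bricks: `dG ue` (the code of `D[e]`), `hdrπG ue = 1^{|π_e|}`,
  `ptG ue uq` (the code of `π_e[q]`), with value lemmas `dG_argOf`, `ptG_argOf`;
* **Stage C**: `rangeAF = [e < |D| ∧ q + 1 < |π_e|]`, `c1BF = [e < |D|]`
  (`rangeAF_argOf_eq_true_iff`, `c1BF_argOf`);
* **Stage D**, generic in the point bricks: `runPtG pa pb uc` — the sign–magnitude code of the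
  translated run point `runPt k a (b - a) c + v` (`runPtG_argOf`) — and `cornerPtG pa pb uc`, the
  translated corner `cornerOf k a (b - a) c + v` (the side vector `sideVec u` by the one-bit zero
  test `zIsZeroF` on `u.2`; `cornerPtG_argOf`);
* **`pieceAF`** (`= iteFn rangeAF ⟨⟨runPt t, runPt (t+1)⟩, ε⟩ ε`) with **`pieceAF_argOf`**:
  `pieceAF ⟨ctx, 1ⁱ⟩ = scaledPieceFlat k Λ D (cV v) i` for EVERY `i`; **`pieceBF`** (the `m`-th of
  the three new edges `p p′`, `p′ q′`, `q′ q` of the `j`-th square of `D[e]`, feet the run points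
  `2j + 2`, `2j + 3` of the first unit step) with **`pieceBF_argOf`**:
  `pieceBF ⟨ctx, 1ⁱ⟩ = squarePieceFlat k β D (cV v) i` whenever every drawn path has at least two
  points (true for a valid drawing; `sqSite_eq`, `sqEdge_sqSite`); `pieceAF_mem_FP`,
  `pieceBF_mem_FP`;
* the trajectory bounds `length_pieceAF_argOf_le`, `length_pieceBF_argOf_le` (pieces have at
  most `pieceClip · (|ctx| + 1)` symbols for a valid drawing: coordinates are
  `k a + c u + v (+ side)` with unit `u`, `c ≤ k`, and `k = 2N² + 5 < 2^{2N+3}`,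
  `squaresK_lt_two_pow`, `ctx_sizes`), so that clipping (`Brick.clipF`) never bites where the
  value matters;
* the folds **`genAFn`**, **`genBFn`** (`sndPow 2 ∘ foldLoop appF (clipF pieceClip piece) p ∘
  genInitG p`, round polynomials `sqPolyA = 5 (X+1)⁴ ≥ scaledTotal`, `sqPolyB = 3 (X+1)³ ≥
  squareTotal`), **`genSqItemsFn y = genAFn y ++ genBFn y`**, **`genSqItemsFn_mem_FP`**, and
  **`genSqItemsFn_ctx`**: for a valid drawing, `genSqItemsFn (ctx (encode (P, D, s, t)) (maxEdges D) v)
  = ccat (scaledPieceFlat k Λ D (cV v)) (scaledTotal k Λ D) ++ ccat (squarePieceFlat k β D (cV v))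
  (squareTotal β D)` — by `framesOf_squaresInstance`, the items part of the `Encoding.listBool`
  code of `(squaresInstance P D s t).1` for `v = -σ` (`genSqItemsFn_ctx_eq_encList`).

What remains of the machine `squaresReduce ∈ FP` after this file: the context builder from the
canonical code (`1^Λ` by the max-fold `TowerGen.lamFn`; `σ = k • P[s]` by `lookupF`), the unary
header `1^{|E₃|}` (`length_squaresInstance_fst`), `τ - σ`, the branch on validity / `N ≥ 2`
(`shiftValidF`, `shiftGeTwoF` of `GridSAWSquaresShiftFP.lean`, the canonicaliser
`canonDrawnGraphFn`), and the comparison with `squaresReduce` — the sequel, on the model of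
`GridSAWTowersMachine.lean`.

## References

* M. Liśkiewicz, M. Ogihara, S. Toda, *The complexity of counting self-avoiding walks in
  subgraphs of two-dimensional grids and hypercubes*, TCS 304 (2003) 129–156, §4, proof of
  Theorem 7 (fourth type: `E₃`, "attach above the line `β` unit-size squares"; `R₁` is
  polynomial-time by §2.2).
* S. Arora, B. Barak, *Computational Complexity: A Modern Approach*, CUP 2009, §1.3 (polynomial
  time is closed under composition and bounded loops), §0.1 (codes of pairs and lists).
-/

noncomputable section

namespace Literature.Barriers.CriticalPhenomena.GridSAW

open _root_.Computability Literature.Computability.Complexity Literature.Computability.Complexity.Brick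
  Polynomial

namespace SquaresGen

open TowerGen

/-! ### Derived unary constants: `1^N`, `1^β`, `1^k` -/

/-- `1^N`, `N = |P|`: the header of the point-list code, the first field of the presentation code.
[folklore] -/
def uNF : List Bool → List Bool := fstF ∘ fstF ∘ wF
/-- `1^β`, `β = N · N + 1` (`squaresBeta`). [cite: LiskiewiczOgiharaToda2003, §4 (proof of Theorem 7, fourth type: β)] -/
def uBetaF : List Bool → List Bool := appF ∘ fanoutFn (HashBricks.umulFn ∘ fanoutFn uNF uNF) fun _ => [true]
/-- `1^k`, `k = 2β + 3` (`squaresK`, the enlargement factor). [cite: LiskiewiczOgiharaToda2003, §4 (proof of Theorem 7: "We enlarge … by a factor")] -/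
def uFacF : List Bool → List Bool := appF ∘ fanoutFn (onesMulFn 2 ∘ uBetaF) fun _ => [true, true, true]
/-- `dpEnc k`. [folklore] -/
def zFacF : List Bool → List Bool := natZF ∘ uFacF

/-- `uNF ∈ FP`. [folklore] -/
theorem uNF_mem_FP : uNF ∈ FP := comp_mem_FP fstF_mem_FP (comp_mem_FP fstF_mem_FP wF_mem_FP)
/-- `uBetaF ∈ FP`. [folklore] -/
theorem uBetaF_mem_FP : uBetaF ∈ FP :=
  comp_mem_FP appF_mem_FP (fanoutFn_mem_FP (comp_mem_FP HashBricks.umulFn_mem_FP (fanoutFn_mem_FP uNF_mem_FP uNF_mem_FP))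
    (const_mem_FP _))
/-- `uFacF ∈ FP`. [folklore] -/
theorem uFacF_mem_FP : uFacF ∈ FP :=
  comp_mem_FP appF_mem_FP (fanoutFn_mem_FP (comp_mem_FP (onesMulFn_mem_FP 2) uBetaF_mem_FP) (const_mem_FP _))
/-- `zFacF ∈ FP`. [folklore] -/
theorem zFacF_mem_FP : zFacF ∈ FP := comp_mem_FP natZF_mem_FP uFacF_mem_FP

section Constants

variable (P : List GridPoint) (D : List DrawnEdge) (s t Λ : ℕ) (v : GridPoint) (i : ℕ)

/-- Value of `uNF` on the piece argument of a presentation. [folklore] -/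
theorem uNF_argOf : uNF (argOf P D s t Λ v i) = ones P.length := by
  rw [uNF, Function.comp_apply, Function.comp_apply, wF_arg, encDG_eq, fstF_boolPair, encPL_eq, fstF_boolPair]
/-- Value of `uBetaF` on the piece argument of a presentation. [folklore] -/
theorem uBetaF_argOf : uBetaF (argOf P D s t Λ v i) = ones (squaresBeta P.length) := by
  rw [uBetaF, Function.comp_apply, fanoutFn_apply, Function.comp_apply, fanoutFn_apply, uNF_argOf,
    HashBricks.umulFn_boolPair, appF_boolPair, show [true] = ones 1 from rfl, Com.ones_append, squaresBeta]
/-- Value of `uFacF` on the piece argument of a presentation. [folklore] -/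
theorem uFacF_argOf : uFacF (argOf P D s t Λ v i) = ones (squaresK P.length) := by
  rw [uFacF, Function.comp_apply, fanoutFn_apply, Function.comp_apply, uBetaF_argOf, onesMulFn_ones, appF_boolPair,
    show [true, true, true] = ones 3 from rfl, Com.ones_append, squaresK]
/-- Value of `zFacF` on the piece argument of a presentation. [folklore] -/
theorem zFacF_argOf : zFacF (argOf P D s t Λ v i) = dpEnc (squaresK P.length) := by
  rw [zFacF, Function.comp_apply, uFacF_argOf, natZF_ones]

end Constants

/-! ### Stage A: the mixed-radix indices of the two families, in unary -/

/-- Family A: `⟨1ᵉ, 1^r⟩ = divmod (i, Λ · k)`. [folklore] -/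
def dmA1F : List Bool → List Bool :=
  Plumb.divModFn ∘ fanoutFn (HashBricks.umulFn ∘ fanoutFn lamF uFacF) idxF
/-- Family A: `⟨1^q, 1ᵗ⟩ = divmod (r, k)`. [folklore] -/
def dmA2F : List Bool → List Bool := Plumb.divModFn ∘ fanoutFn uFacF (sndF ∘ dmA1F)
/-- `1ᵉ` (family A). [folklore] -/
def ueAF : List Bool → List Bool := fstF ∘ dmA1F
/-- `1^q` (family A). [folklore] -/
def uqAF : List Bool → List Bool := fstF ∘ dmA2F
/-- `1ᵗ` (family A). [folklore] -/
def utAF : List Bool → List Bool := sndF ∘ dmA2F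

/-- Family B: `⟨1ᵉ, 1^r⟩ = divmod (i, β · 3)`. [folklore] -/
def dmB1F : List Bool → List Bool :=
  Plumb.divModFn ∘ fanoutFn (HashBricks.umulFn ∘ fanoutFn uBetaF fun _ => ones 3) idxF
/-- Family B: `⟨1ʲ, 1ᵐ⟩ = divmod (r, 3)`. [folklore] -/
def dmB2F : List Bool → List Bool := Plumb.divModFn ∘ fanoutFn (fun _ => ones 3) (sndF ∘ dmB1F)
/-- `1ᵉ` (family B). [folklore] -/
def ueBF : List Bool → List Bool := fstF ∘ dmB1F
/-- `1ʲ` (family B). [folklore] -/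
def ujBF : List Bool → List Bool := fstF ∘ dmB2F
/-- `1ᵐ` (family B). [folklore] -/
def umBF : List Bool → List Bool := sndF ∘ dmB2F

/-- `dmA1F ∈ FP`. [folklore] -/
theorem dmA1F_mem_FP : dmA1F ∈ FP :=
  comp_mem_FP Plumb.divModFn_mem_FP (fanoutFn_mem_FP
    (comp_mem_FP HashBricks.umulFn_mem_FP (fanoutFn_mem_FP lamF_mem_FP uFacF_mem_FP)) idxF_mem_FP)
/-- `dmA2F ∈ FP`. [folklore] -/
theorem dmA2F_mem_FP : dmA2F ∈ FP :=
  comp_mem_FP Plumb.divModFn_mem_FP (fanoutFn_mem_FP uFacF_mem_FP (comp_mem_FP sndF_mem_FP dmA1F_mem_FP))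
/-- `ueAF ∈ FP`. [folklore] -/
theorem ueAF_mem_FP : ueAF ∈ FP := comp_mem_FP fstF_mem_FP dmA1F_mem_FP
/-- `uqAF ∈ FP`. [folklore] -/
theorem uqAF_mem_FP : uqAF ∈ FP := comp_mem_FP fstF_mem_FP dmA2F_mem_FP
/-- `utAF ∈ FP`. [folklore] -/
theorem utAF_mem_FP : utAF ∈ FP := comp_mem_FP sndF_mem_FP dmA2F_mem_FP
/-- `dmB1F ∈ FP`. [folklore] -/
theorem dmB1F_mem_FP : dmB1F ∈ FP :=
  comp_mem_FP Plumb.divModFn_mem_FP (fanoutFn_mem_FP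
    (comp_mem_FP HashBricks.umulFn_mem_FP (fanoutFn_mem_FP uBetaF_mem_FP (const_mem_FP _))) idxF_mem_FP)
/-- `dmB2F ∈ FP`. [folklore] -/
theorem dmB2F_mem_FP : dmB2F ∈ FP :=
  comp_mem_FP Plumb.divModFn_mem_FP (fanoutFn_mem_FP (const_mem_FP _) (comp_mem_FP sndF_mem_FP dmB1F_mem_FP))
/-- `ueBF ∈ FP`. [folklore] -/
theorem ueBF_mem_FP : ueBF ∈ FP := comp_mem_FP fstF_mem_FP dmB1F_mem_FP
/-- `ujBF ∈ FP`. [folklore] -/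
theorem ujBF_mem_FP : ujBF ∈ FP := comp_mem_FP fstF_mem_FP dmB2F_mem_FP
/-- `umBF ∈ FP`. [folklore] -/
theorem umBF_mem_FP : umBF ∈ FP := comp_mem_FP sndF_mem_FP dmB2F_mem_FP

/-- The radix components of family A: `e = i / (Λ k)`. [folklore] -/
def idxAE (k Λ i : ℕ) : ℕ := i / (Λ * k)
/-- `q = i % (Λ k) / k`. [folklore] -/
def idxAQ (k Λ i : ℕ) : ℕ := i % (Λ * k) / k
/-- `t = i % (Λ k) % k`. [folklore] -/
def idxAT (k Λ i : ℕ) : ℕ := i % (Λ * k) % k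
/-- The radix components of family B: `e = i / (β · 3)`. [folklore] -/
def idxBE (β i : ℕ) : ℕ := i / (β * 3)
/-- `j = i % (β · 3) / 3`. [folklore] -/
def idxBJ (β i : ℕ) : ℕ := i % (β * 3) / 3
/-- `m = i % (β · 3) % 3`. [folklore] -/
def idxBM (β i : ℕ) : ℕ := i % (β * 3) % 3

/-- The flat piece of family A through the radix components. [folklore] -/
theorem scaledPieceFlat_eq (k Λ : ℕ) (D : List DrawnEdge) (c : GridPoint × GridPoint → List Bool) (i : ℕ) :
    scaledPieceFlat k Λ D c i = scaledPieceAt k D c (idxAE k Λ i) (idxAQ k Λ i) (idxAT k Λ i) := rfl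
/-- The flat piece of family B through the radix components. [folklore] -/
theorem squarePieceFlat_eq (k β : ℕ) (D : List DrawnEdge) (c : GridPoint × GridPoint → List Bool) (i : ℕ) :
    squarePieceFlat k β D c i = squarePieceAt k D c (idxBE β i) (idxBJ β i) (idxBM β i) := rfl
/-- `m < 3`. [folklore] -/
theorem idxBM_lt (β i : ℕ) : idxBM β i < 3 := Nat.mod_lt _ (by norm_num)

section IdxApply

variable (P : List GridPoint) (D : List DrawnEdge) (s t Λ : ℕ) (v : GridPoint) (i : ℕ)

/-- Value of `dmA1F` on the piece argument of a presentation. [folklore] -/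
theorem dmA1F_argOf : dmA1F (argOf P D s t Λ v i) =
    boolPair (ones (i / (Λ * squaresK P.length))) (ones (i % (Λ * squaresK P.length))) := by
  simp only [dmA1F, Function.comp_apply, fanoutFn_apply, lamF_arg, uFacF_argOf, idxF_arg,
    HashBricks.umulFn_boolPair, Plumb.divModFn_boolPair]
/-- Value of `dmA2F` on the piece argument of a presentation. [folklore] -/
theorem dmA2F_argOf : dmA2F (argOf P D s t Λ v i) =
    boolPair (ones (idxAQ (squaresK P.length) Λ i)) (ones (idxAT (squaresK P.length) Λ i)) := by
  simp only [dmA2F, Function.comp_apply, fanoutFn_apply, uFacF_argOf, dmA1F_argOf, sndF_boolPair,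
    Plumb.divModFn_boolPair, idxAQ, idxAT]
/-- Value of `ueAF` on the piece argument of a presentation. [folklore] -/
theorem ueAF_argOf : ueAF (argOf P D s t Λ v i) = ones (idxAE (squaresK P.length) Λ i) := by
  rw [ueAF, Function.comp_apply, dmA1F_argOf, fstF_boolPair, idxAE]
/-- Value of `uqAF` on the piece argument of a presentation. [folklore] -/
theorem uqAF_argOf : uqAF (argOf P D s t Λ v i) = ones (idxAQ (squaresK P.length) Λ i) := by
  rw [uqAF, Function.comp_apply, dmA2F_argOf, fstF_boolPair]
/-- Value of `utAF` on the piece argument of a presentation. [folklore] -/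
theorem utAF_argOf : utAF (argOf P D s t Λ v i) = ones (idxAT (squaresK P.length) Λ i) := by
  rw [utAF, Function.comp_apply, dmA2F_argOf, sndF_boolPair]
/-- Value of `dmB1F` on the piece argument of a presentation. [folklore] -/
theorem dmB1F_argOf : dmB1F (argOf P D s t Λ v i) =
    boolPair (ones (i / (squaresBeta P.length * 3))) (ones (i % (squaresBeta P.length * 3))) := by
  simp only [dmB1F, Function.comp_apply, fanoutFn_apply, uBetaF_argOf, idxF_arg,
    HashBricks.umulFn_boolPair, Plumb.divModFn_boolPair]
/-- Value of `dmB2F` on the piece argument of a presentation. [folklore] -/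
theorem dmB2F_argOf : dmB2F (argOf P D s t Λ v i) =
    boolPair (ones (idxBJ (squaresBeta P.length) i)) (ones (idxBM (squaresBeta P.length) i)) := by
  simp only [dmB2F, Function.comp_apply, fanoutFn_apply, dmB1F_argOf, sndF_boolPair,
    Plumb.divModFn_boolPair, idxBJ, idxBM]
/-- Value of `ueBF` on the piece argument of a presentation. [folklore] -/
theorem ueBF_argOf : ueBF (argOf P D s t Λ v i) = ones (idxBE (squaresBeta P.length) i) := by
  rw [ueBF, Function.comp_apply, dmB1F_argOf, fstF_boolPair, idxBE]
/-- Value of `ujBF` on the piece argument of a presentation. [folklore] -/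
theorem ujBF_argOf : ujBF (argOf P D s t Λ v i) = ones (idxBJ (squaresBeta P.length) i) := by
  rw [ujBF, Function.comp_apply, dmB2F_argOf, fstF_boolPair]
/-- Value of `umBF` on the piece argument of a presentation. [folklore] -/
theorem umBF_argOf : umBF (argOf P D s t Λ v i) = ones (idxBM (squaresBeta P.length) i) := by
  rw [umBF, Function.comp_apply, dmB2F_argOf, sndF_boolPair]

end IdxApply

/-! ### Stage B: fetching `D[e]` and a point of its path, for any index bricks -/

section Fetch

variable (ue uq : List Bool → List Bool)

/-- The code of the drawn edge `D[e]`, `1ᵉ` supplied by the brick `ue`. [folklore] -/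
def dG : List Bool → List Bool := HashBricks.nthItemFn ∘ fanoutFn ue itemsDF
/-- The code of its path `π_e`. [folklore] -/
def cπG : List Bool → List Bool := sndPow 1 ∘ dG ue
/-- `1^{|π_e|}`. [folklore] -/
def hdrπG : List Bool → List Bool := fstF ∘ cπG ue
/-- The items of `π_e`. [folklore] -/
def itemsπG : List Bool → List Bool := sndF ∘ cπG ue
/-- The code of the point `π_e[q]`, `1^q` supplied by the brick `uq`. [folklore] -/
def ptG : List Bool → List Bool := HashBricks.nthItemFn ∘ fanoutFn uq (itemsπG ue)

variable {ue uq}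

/-- `dG ue ∈ FP`. [folklore] -/
theorem dG_mem_FP (h : ue ∈ FP) : dG ue ∈ FP := comp_mem_FP HashBricks.nthItemFn_mem_FP (fanoutFn_mem_FP h itemsDF_mem_FP)
/-- `cπG ue ∈ FP`. [folklore] -/
theorem cπG_mem_FP (h : ue ∈ FP) : cπG ue ∈ FP := comp_mem_FP (sndPow_mem_FP 1) (dG_mem_FP h)
/-- `hdrπG ue ∈ FP`. [folklore] -/
theorem hdrπG_mem_FP (h : ue ∈ FP) : hdrπG ue ∈ FP := comp_mem_FP fstF_mem_FP (cπG_mem_FP h)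
/-- `itemsπG ue ∈ FP`. [folklore] -/
theorem itemsπG_mem_FP (h : ue ∈ FP) : itemsπG ue ∈ FP := comp_mem_FP sndF_mem_FP (cπG_mem_FP h)
/-- `ptG ue uq ∈ FP`. [folklore] -/
theorem ptG_mem_FP (h : ue ∈ FP) (h' : uq ∈ FP) : ptG ue uq ∈ FP :=
  comp_mem_FP HashBricks.nthItemFn_mem_FP (fanoutFn_mem_FP h' (itemsπG_mem_FP h))

variable (P : List GridPoint) {D : List DrawnEdge} (s t : ℕ) {Λ : ℕ} (v : GridPoint) {i e q : ℕ}

/-- Value of `dG` on the piece argument of a presentation. [folklore] -/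
theorem dG_argOf (hue : ue (argOf P D s t Λ v i) = ones e) (he : e < D.length) :
    dG ue (argOf P D s t Λ v i) = encDE (D[e]) := by
  rw [dG, Function.comp_apply, fanoutFn_apply, hue, itemsDF_argOf, nthItemFn_encList_map _ he]
/-- Value of `cπG` on the piece argument of a presentation. [folklore] -/
theorem cπG_argOf (hue : ue (argOf P D s t Λ v i) = ones e) (he : e < D.length) :
    cπG ue (argOf P D s t Λ v i) = encPL (D[e]).2.2 := by
  rw [cπG, Function.comp_apply, dG_argOf P s t v hue he, encDE_eq]; simp [sndPow]
/-- Value of `hdrπG` on the piece argument of a presentation. [folklore] -/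
theorem hdrπG_argOf (hue : ue (argOf P D s t Λ v i) = ones e) (he : e < D.length) :
    hdrπG ue (argOf P D s t Λ v i) = ones (D[e]).2.2.length := by
  rw [hdrπG, Function.comp_apply, cπG_argOf P s t v hue he, encPL_eq, fstF_boolPair]
/-- Value of `itemsπG` on the piece argument of a presentation. [folklore] -/
theorem itemsπG_argOf (hue : ue (argOf P D s t Λ v i) = ones e) (he : e < D.length) :
    itemsπG ue (argOf P D s t Λ v i) = encList ((D[e]).2.2.map encPt) := by
  rw [itemsπG, Function.comp_apply, cπG_argOf P s t v hue he, encPL_eq, sndF_boolPair]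
/-- Value of `ptG` on the piece argument of a presentation. [folklore] -/
theorem ptG_argOf (hue : ue (argOf P D s t Λ v i) = ones e) (he : e < D.length)
    (huq : uq (argOf P D s t Λ v i) = ones q) (hq : q < (D[e]).2.2.length) :
    ptG ue uq (argOf P D s t Λ v i) = encPt ((D[e]).2.2[q]) := by
  rw [ptG, Function.comp_apply, fanoutFn_apply, huq, itemsπG_argOf P s t v hue he, nthItemFn_encList_map _ hq]

end Fetch

/-! ### Stage C: the range conditions -/

/-- Family A: `[e < |D|]`. [folklore] -/
def c1AF : List Bool → List Bool := ltLenF ∘ fanoutFn ueAF hdrDF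
/-- Family A: `[q + 1 < |π_e|]`. [folklore] -/
def c2AF : List Bool → List Bool := ltLenF ∘ fanoutFn (List.cons true ∘ uqAF) (hdrπG ueAF)
/-- Family A: both range conditions. [folklore] -/
def rangeAF : List Bool → List Bool := andFn c1AF c2AF
/-- Family B: `[e < |D|]` (the only range condition: `j < β` and `m < 3` by construction). [folklore] -/
def c1BF : List Bool → List Bool := ltLenF ∘ fanoutFn ueBF hdrDF

/-- `c1AF ∈ FP`. [folklore] -/
theorem c1AF_mem_FP : c1AF ∈ FP := comp_mem_FP ltLenF_mem_FP (fanoutFn_mem_FP ueAF_mem_FP hdrDF_mem_FP)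
/-- `c2AF ∈ FP`. [folklore] -/
theorem c2AF_mem_FP : c2AF ∈ FP :=
  comp_mem_FP ltLenF_mem_FP (fanoutFn_mem_FP (comp_mem_FP (cons_mem_FP true) uqAF_mem_FP) (hdrπG_mem_FP ueAF_mem_FP))
/-- `rangeAF ∈ FP`. [folklore] -/
theorem rangeAF_mem_FP : rangeAF ∈ FP := andFn_mem_FP c1AF_mem_FP c2AF_mem_FP
/-- `c1BF ∈ FP`. [folklore] -/
theorem c1BF_mem_FP : c1BF ∈ FP := comp_mem_FP ltLenF_mem_FP (fanoutFn_mem_FP ueBF_mem_FP hdrDF_mem_FP)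

/-- `c2AF` is one-bit. [folklore] -/
theorem oneBit_c2AF : OneBit c2AF := oneBit_ltLenF.comp _
/-- `rangeAF` is one-bit. [folklore] -/
theorem oneBit_rangeAF : OneBit rangeAF := oneBit_andFn (oneBit_ltLenF.comp _) oneBit_c2AF
/-- `c1BF` is one-bit. [folklore] -/
theorem oneBit_c1BF : OneBit c1BF := oneBit_ltLenF.comp _

section CondApply

variable (P : List GridPoint) (D : List DrawnEdge) (s t Λ : ℕ) (v : GridPoint) (i : ℕ)

/-- Value of `c1AF` on the piece argument of a presentation. [folklore] -/
theorem c1AF_argOf : c1AF (argOf P D s t Λ v i) = [decide (idxAE (squaresK P.length) Λ i < D.length)] := by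
  rw [c1AF, Function.comp_apply, fanoutFn_apply, ueAF_argOf, hdrDF_argOf, ltLenF_ones]

/-- Value of `c1BF` on the piece argument of a presentation. [folklore] -/
theorem c1BF_argOf : c1BF (argOf P D s t Λ v i) = [decide (idxBE (squaresBeta P.length) i < D.length)] := by
  rw [c1BF, Function.comp_apply, fanoutFn_apply, ueBF_argOf, hdrDF_argOf, ltLenF_ones]

variable {D Λ i}

/-- Value of `c2AF` on the piece argument of a presentation. [folklore] -/
theorem c2AF_argOf (he : idxAE (squaresK P.length) Λ i < D.length) :
    c2AF (argOf P D s t Λ v i) =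
      [decide (idxAQ (squaresK P.length) Λ i + 1 < (D[idxAE (squaresK P.length) Λ i]).2.2.length)] := by
  rw [c2AF, Function.comp_apply, fanoutFn_apply, Function.comp_apply, uqAF_argOf, ← Com.ones_succ,
    hdrπG_argOf P s t v (ueAF_argOf P D s t Λ v i) he, ltLenF_ones]

/-- **The range condition of family A** holds iff `e < |D|` and `q + 1 < |π_e|`. [folklore] -/
theorem rangeAF_argOf_eq_true_iff (D : List DrawnEdge) (Λ i : ℕ) :
    rangeAF (argOf P D s t Λ v i) = [true] ↔
      ∃ he : idxAE (squaresK P.length) Λ i < D.length,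
        idxAQ (squaresK P.length) Λ i + 1 < (D[idxAE (squaresK P.length) Λ i]).2.2.length := by
  by_cases he : idxAE (squaresK P.length) Λ i < D.length
  · rw [rangeAF, andFn_apply (c1AF_argOf P D s t Λ v i) (c2AF_argOf P s t v he)]
    simp [he]
  · obtain ⟨b, hb⟩ := oneBit_c2AF (argOf P D s t Λ v i)
    rw [rangeAF, andFn_apply (c1AF_argOf P D s t Λ v i) hb]
    simp [he]

end CondApply

/-! ### Stage D: translated run points and corners, for any point bricks -/

/-- The one-bit zero test on canonical difference pairs: both components empty. [folklore] -/
def zIsZeroF : List Bool → List Bool := andFn (isNilFn ∘ fstF) (isNilFn ∘ sndF)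

/-- `zIsZeroF ∈ FP`. [folklore] -/
theorem zIsZeroF_mem_FP : zIsZeroF ∈ FP :=
  andFn_mem_FP (comp_mem_FP isNilFn_mem_FP fstF_mem_FP) (comp_mem_FP isNilFn_mem_FP sndF_mem_FP)

/-- `zIsZeroF` is one-bit. [folklore] -/
theorem oneBit_zIsZeroF : OneBit zIsZeroF := oneBit_andFn (oneBit_isNilFn.comp _) (oneBit_isNilFn.comp _)

/-- **`zIsZeroF (dpEnc z) = [z = 0]`** (the canonical code of `z` has `|bin |z||` numeral symbols
in all). [folklore] -/
theorem zIsZeroF_dpEnc (z : ℤ) : zIsZeroF (dpEnc z) = [decide (z = 0)] := by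
  rw [zIsZeroF, dpEnc_eq, andFn_apply (b := decide (Com.cP z = [])) (b' := decide (Com.cQ z = []))
    (by simp [isNilFn]) (by simp [isNilFn])]
  congr 1
  have h := Com.length_cP_add_length_cQ z
  rw [Bool.eq_iff_iff]
  simp only [Bool.and_eq_true, decide_eq_true_eq]
  constructor
  · rintro ⟨h1, h2⟩
    rw [h1, h2] at h
    have h0 : encodeNat z.natAbs = [] := List.eq_nil_of_length_eq_zero (by simpa using h.symm)
    have := (encodeNat_eq_nil_iff _).1 h0
    omega
  · rintro rfl
    have h0 : (Com.cP 0).length + (Com.cQ 0).length = 0 := by rw [h]; rfl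
    exact ⟨List.eq_nil_of_length_eq_zero (by omega), List.eq_nil_of_length_eq_zero (by omega)⟩

section Coords

variable (pa pb uc : List Bool → List Bool)

/-- `dpEnc a.1` (`a` the point coded by `pa`). [folklore] -/
def a1G : List Bool → List Bool := ofSMFn ∘ fstF ∘ pa
/-- `dpEnc a.2`. [folklore] -/
def a2G : List Bool → List Bool := ofSMFn ∘ sndF ∘ pa
/-- `dpEnc u.1`, `u = b - a` (`b` the point coded by `pb`). [folklore] -/
def u1G : List Bool → List Bool := zsubF ∘ fanoutFn (ofSMFn ∘ fstF ∘ pb) (a1G pa)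
/-- `dpEnc u.2`. [folklore] -/
def u2G : List Bool → List Bool := zsubF ∘ fanoutFn (ofSMFn ∘ sndF ∘ pb) (a2G pa)
/-- `dpEnc (k a.1 + c u.1 + v.1)`: first coordinate of the translated run point `c` (`1ᶜ` by `uc`).
[folklore] -/
def rx1G : List Bool → List Bool :=
  zaddF ∘ fanoutFn (zaddF ∘ fanoutFn (zmulF ∘ fanoutFn zFacF (a1G pa)) (zmulF ∘ fanoutFn (natZF ∘ uc) (u1G pa pb))) v1F
/-- `dpEnc (k a.2 + c u.2 + v.2)`: second coordinate. [folklore] -/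
def rx2G : List Bool → List Bool :=
  zaddF ∘ fanoutFn (zaddF ∘ fanoutFn (zmulF ∘ fanoutFn zFacF (a2G pa)) (zmulF ∘ fanoutFn (natZF ∘ uc) (u2G pa pb))) v2F
/-- **The sign–magnitude code of the translated run point** `runPt k a u c + v`. [folklore] -/
def runPtG : List Bool → List Bool := fanoutFn (signMagOfZF ∘ rx1G pa pb uc) (signMagOfZF ∘ rx2G pa pb uc)
/-- `dpEnc (sideVec u).1` = `0` if `u.2 = 0`, else `1`. [cite: LiskiewiczOgiharaToda2003, §4 (proof of Theorem 7, E₃: "attach above the line")] -/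
def s1G : List Bool → List Bool := iteFn (zIsZeroF ∘ u2G pa pb) (fun _ => dpEnc 0) fun _ => dpEnc 1
/-- `dpEnc (sideVec u).2` = `1` if `u.2 = 0`, else `0`. [folklore] -/
def s2G : List Bool → List Bool := iteFn (zIsZeroF ∘ u2G pa pb) (fun _ => dpEnc 1) fun _ => dpEnc 0
/-- **The sign–magnitude code of the translated corner** `cornerOf k a u c + v = runPt k a u c + sideVec u + v`.
[cite: LiskiewiczOgiharaToda2003, §4 (proof of Theorem 7, E₃, Fig. 8)] -/
def cornerPtG : List Bool → List Bool :=
  fanoutFn (signMagOfZF ∘ zaddF ∘ fanoutFn (rx1G pa pb uc) (s1G pa pb))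
    (signMagOfZF ∘ zaddF ∘ fanoutFn (rx2G pa pb uc) (s2G pa pb))

variable {pa pb uc}

/-- `a1G pa ∈ FP`. [folklore] -/
theorem a1G_mem_FP (ha : pa ∈ FP) : a1G pa ∈ FP := comp_mem_FP ofSMFn_mem_FP (comp_mem_FP fstF_mem_FP ha)
/-- `a2G pa ∈ FP`. [folklore] -/
theorem a2G_mem_FP (ha : pa ∈ FP) : a2G pa ∈ FP := comp_mem_FP ofSMFn_mem_FP (comp_mem_FP sndF_mem_FP ha)
/-- `u1G pa pb ∈ FP`. [folklore] -/
theorem u1G_mem_FP (ha : pa ∈ FP) (hb : pb ∈ FP) : u1G pa pb ∈ FP :=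
  comp_mem_FP zsubF_mem_FP (fanoutFn_mem_FP (comp_mem_FP ofSMFn_mem_FP (comp_mem_FP fstF_mem_FP hb)) (a1G_mem_FP ha))
/-- `u2G pa pb ∈ FP`. [folklore] -/
theorem u2G_mem_FP (ha : pa ∈ FP) (hb : pb ∈ FP) : u2G pa pb ∈ FP :=
  comp_mem_FP zsubF_mem_FP (fanoutFn_mem_FP (comp_mem_FP ofSMFn_mem_FP (comp_mem_FP sndF_mem_FP hb)) (a2G_mem_FP ha))
/-- `rx1G pa pb uc ∈ FP`. [folklore] -/
theorem rx1G_mem_FP (ha : pa ∈ FP) (hb : pb ∈ FP) (hc : uc ∈ FP) : rx1G pa pb uc ∈ FP :=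
  comp_mem_FP zaddF_mem_FP (fanoutFn_mem_FP (comp_mem_FP zaddF_mem_FP (fanoutFn_mem_FP
    (comp_mem_FP zmulF_mem_FP (fanoutFn_mem_FP zFacF_mem_FP (a1G_mem_FP ha)))
    (comp_mem_FP zmulF_mem_FP (fanoutFn_mem_FP (comp_mem_FP natZF_mem_FP hc) (u1G_mem_FP ha hb))))) v1F_mem_FP)
/-- `rx2G pa pb uc ∈ FP`. [folklore] -/
theorem rx2G_mem_FP (ha : pa ∈ FP) (hb : pb ∈ FP) (hc : uc ∈ FP) : rx2G pa pb uc ∈ FP :=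
  comp_mem_FP zaddF_mem_FP (fanoutFn_mem_FP (comp_mem_FP zaddF_mem_FP (fanoutFn_mem_FP
    (comp_mem_FP zmulF_mem_FP (fanoutFn_mem_FP zFacF_mem_FP (a2G_mem_FP ha)))
    (comp_mem_FP zmulF_mem_FP (fanoutFn_mem_FP (comp_mem_FP natZF_mem_FP hc) (u2G_mem_FP ha hb))))) v2F_mem_FP)
/-- `runPtG pa pb uc ∈ FP`. [folklore] -/
theorem runPtG_mem_FP (ha : pa ∈ FP) (hb : pb ∈ FP) (hc : uc ∈ FP) : runPtG pa pb uc ∈ FP :=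
  fanoutFn_mem_FP (comp_mem_FP signMagOfZF_mem_FP (rx1G_mem_FP ha hb hc))
    (comp_mem_FP signMagOfZF_mem_FP (rx2G_mem_FP ha hb hc))
/-- `s1G pa pb ∈ FP`. [folklore] -/
theorem s1G_mem_FP (ha : pa ∈ FP) (hb : pb ∈ FP) : s1G pa pb ∈ FP :=
  iteFn_mem_FP (comp_mem_FP zIsZeroF_mem_FP (u2G_mem_FP ha hb)) (const_mem_FP _) (const_mem_FP _)
/-- `s2G pa pb ∈ FP`. [folklore] -/
theorem s2G_mem_FP (ha : pa ∈ FP) (hb : pb ∈ FP) : s2G pa pb ∈ FP :=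
  iteFn_mem_FP (comp_mem_FP zIsZeroF_mem_FP (u2G_mem_FP ha hb)) (const_mem_FP _) (const_mem_FP _)
/-- `cornerPtG pa pb uc ∈ FP`. [folklore] -/
theorem cornerPtG_mem_FP (ha : pa ∈ FP) (hb : pb ∈ FP) (hc : uc ∈ FP) : cornerPtG pa pb uc ∈ FP :=
  fanoutFn_mem_FP
    (comp_mem_FP signMagOfZF_mem_FP (comp_mem_FP zaddF_mem_FP (fanoutFn_mem_FP (rx1G_mem_FP ha hb hc) (s1G_mem_FP ha hb))))
    (comp_mem_FP signMagOfZF_mem_FP (comp_mem_FP zaddF_mem_FP (fanoutFn_mem_FP (rx2G_mem_FP ha hb hc) (s2G_mem_FP ha hb))))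

variable (P : List GridPoint) (D : List DrawnEdge) (s t Λ : ℕ) (v : GridPoint) (i : ℕ) {a b : GridPoint} {c : ℕ}

/-- Value of `u1G`, `u2G` on the piece argument of a presentation. [folklore] -/
theorem uG_argOf (hpa : pa (argOf P D s t Λ v i) = encPt a) (hpb : pb (argOf P D s t Λ v i) = encPt b) :
    u1G pa pb (argOf P D s t Λ v i) = dpEnc (b.1 - a.1) ∧ u2G pa pb (argOf P D s t Λ v i) = dpEnc (b.2 - a.2) := by
  constructor
  · rw [u1G, Function.comp_apply, fanoutFn_apply, Function.comp_apply, Function.comp_apply, hpb, encPt_eq,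
      fstF_boolPair, ofSMFn_encInt, a1G, Function.comp_apply, Function.comp_apply, hpa, encPt_eq, fstF_boolPair,
      ofSMFn_encInt, zsubF_boolPair, ival_dpEnc, ival_dpEnc]
  · rw [u2G, Function.comp_apply, fanoutFn_apply, Function.comp_apply, Function.comp_apply, hpb, encPt_eq,
      sndF_boolPair, ofSMFn_encInt, a2G, Function.comp_apply, Function.comp_apply, hpa, encPt_eq, sndF_boolPair,
      ofSMFn_encInt, zsubF_boolPair, ival_dpEnc, ival_dpEnc]

/-- Value of `rx1G`, `rx2G` on the piece argument of a presentation: the coordinates of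
`runPt k a (b - a) c + v`. [folklore] -/
theorem rxG_argOf (hpa : pa (argOf P D s t Λ v i) = encPt a) (hpb : pb (argOf P D s t Λ v i) = encPt b)
    (huc : uc (argOf P D s t Λ v i) = ones c) :
    rx1G pa pb uc (argOf P D s t Λ v i) = dpEnc (runPt (squaresK P.length) a (b - a) c + v).1 ∧
      rx2G pa pb uc (argOf P D s t Λ v i) = dpEnc (runPt (squaresK P.length) a (b - a) c + v).2 := by
  obtain ⟨hu1, hu2⟩ := uG_argOf P D s t Λ v i hpa hpb
  have ha1 : a1G pa (argOf P D s t Λ v i) = dpEnc a.1 := by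
    rw [a1G, Function.comp_apply, Function.comp_apply, hpa, encPt_eq, fstF_boolPair, ofSMFn_encInt]
  have ha2 : a2G pa (argOf P D s t Λ v i) = dpEnc a.2 := by
    rw [a2G, Function.comp_apply, Function.comp_apply, hpa, encPt_eq, sndF_boolPair, ofSMFn_encInt]
  constructor
  · simp only [rx1G, Function.comp_apply, fanoutFn_apply, zFacF_argOf, ha1, hu1, huc, natZF_ones, v1F_arg,
      zmulF_boolPair, zaddF_boolPair, ival_dpEnc, Prod.fst_add, runPt_fst, Prod.fst_sub]
  · simp only [rx2G, Function.comp_apply, fanoutFn_apply, zFacF_argOf, ha2, hu2, huc, natZF_ones, v2F_arg,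
      zmulF_boolPair, zaddF_boolPair, ival_dpEnc, Prod.snd_add, runPt_snd, Prod.snd_sub]

/-- **Value of `runPtG`**: the code of the translated run point. [folklore] -/
theorem runPtG_argOf (hpa : pa (argOf P D s t Λ v i) = encPt a) (hpb : pb (argOf P D s t Λ v i) = encPt b)
    (huc : uc (argOf P D s t Λ v i) = ones c) :
    runPtG pa pb uc (argOf P D s t Λ v i) = encPt (runPt (squaresK P.length) a (b - a) c + v) := by
  obtain ⟨h1, h2⟩ := rxG_argOf P D s t Λ v i hpa hpb huc
  rw [runPtG, fanoutFn_apply, Function.comp_apply, Function.comp_apply, h1, h2, signMagOfZF_dpEnc',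
    signMagOfZF_dpEnc', encPt_eq]

/-- Value of `s1G`, `s2G`: the side vector. [folklore] -/
theorem sG_argOf (hpa : pa (argOf P D s t Λ v i) = encPt a) (hpb : pb (argOf P D s t Λ v i) = encPt b) :
    s1G pa pb (argOf P D s t Λ v i) = dpEnc (sideVec (b - a)).1 ∧
      s2G pa pb (argOf P D s t Λ v i) = dpEnc (sideVec (b - a)).2 := by
  obtain ⟨-, hu2⟩ := uG_argOf P D s t Λ v i hpa hpb
  by_cases h : (b - a).2 = 0
  · have hc : (zIsZeroF ∘ u2G pa pb) (argOf P D s t Λ v i) = [true] := by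
      rw [Function.comp_apply, hu2, zIsZeroF_dpEnc, ← Prod.snd_sub, decide_eq_true h]
    rw [s1G, iteFn_apply_true hc, s2G, iteFn_apply_true hc, sideVec, if_pos h]
    exact ⟨rfl, rfl⟩
  · have hc : (zIsZeroF ∘ u2G pa pb) (argOf P D s t Λ v i) = [false] := by
      rw [Function.comp_apply, hu2, zIsZeroF_dpEnc, ← Prod.snd_sub, decide_eq_false h]
    rw [s1G, iteFn_apply_false hc, s2G, iteFn_apply_false hc, sideVec, if_neg h]
    exact ⟨rfl, rfl⟩

/-- **Value of `cornerPtG`**: the code of the translated corner. [folklore] -/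
theorem cornerPtG_argOf (hpa : pa (argOf P D s t Λ v i) = encPt a) (hpb : pb (argOf P D s t Λ v i) = encPt b)
    (huc : uc (argOf P D s t Λ v i) = ones c) :
    cornerPtG pa pb uc (argOf P D s t Λ v i) = encPt (cornerOf (squaresK P.length) a (b - a) c + v) := by
  obtain ⟨h1, h2⟩ := rxG_argOf P D s t Λ v i hpa hpb huc
  obtain ⟨hs1, hs2⟩ := sG_argOf P D s t Λ v i hpa hpb
  have e1 : (cornerOf (squaresK P.length) a (b - a) c + v).1 =
      (runPt (squaresK P.length) a (b - a) c + v).1 + (sideVec (b - a)).1 := by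
    simp only [cornerOf, Prod.fst_add]; ring
  have e2 : (cornerOf (squaresK P.length) a (b - a) c + v).2 =
      (runPt (squaresK P.length) a (b - a) c + v).2 + (sideVec (b - a)).2 := by
    simp only [cornerOf, Prod.snd_add]; ring
  rw [cornerPtG, fanoutFn_apply, encPt_eq, e1, e2]
  simp only [Function.comp_apply, fanoutFn_apply, h1, h2, hs1, hs2, zaddF_boolPair, ival_dpEnc, signMagOfZF_dpEnc']

end Coords

/-! ### Family A: the piece function of the scaled paths -/

/-- The code of `π_e[q]` (family A). [folklore] -/
def paAF : List Bool → List Bool := ptG ueAF uqAF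
/-- The code of `π_e[q+1]` (family A). [folklore] -/
def pbAF : List Bool → List Bool := ptG ueAF (List.cons true ∘ uqAF)
/-- The code of the `t`-th unit edge of the `q`-th scaled step: its two translated end points.
[folklore] -/
def edgeAF : List Bool → List Bool := fanoutFn (runPtG paAF pbAF utAF) (runPtG paAF pbAF (List.cons true ∘ utAF))
/-- **The piece function of family A**: the frame `⟨edge code, ε⟩` of the unit edge at position
`i`, or nothing out of range. [cite: LiskiewiczOgiharaToda2003, §4 (proof of Theorem 7: R₁ emits E₃, the scaled paths)] -/
def pieceAF : List Bool → List Bool := iteFn rangeAF (fanoutFn edgeAF fun _ => []) fun _ => []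

/-- `paAF ∈ FP`. [folklore] -/
theorem paAF_mem_FP : paAF ∈ FP := ptG_mem_FP ueAF_mem_FP uqAF_mem_FP
/-- `pbAF ∈ FP`. [folklore] -/
theorem pbAF_mem_FP : pbAF ∈ FP := ptG_mem_FP ueAF_mem_FP (comp_mem_FP (cons_mem_FP true) uqAF_mem_FP)
/-- `edgeAF ∈ FP`. [folklore] -/
theorem edgeAF_mem_FP : edgeAF ∈ FP :=
  fanoutFn_mem_FP (runPtG_mem_FP paAF_mem_FP pbAF_mem_FP utAF_mem_FP)
    (runPtG_mem_FP paAF_mem_FP pbAF_mem_FP (comp_mem_FP (cons_mem_FP true) utAF_mem_FP))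
/-- **`pieceAF ∈ FP`.** [cite: AroraBarak2009, §1.3 (closure of polynomial time under composition)] -/
theorem pieceAF_mem_FP : pieceAF ∈ FP :=
  iteFn_mem_FP rangeAF_mem_FP (fanoutFn_mem_FP edgeAF_mem_FP (const_mem_FP _)) (const_mem_FP _)

/-- The flat piece of family A in closed form, in range. [folklore] -/
theorem scaledPieceAt_of_range {k : ℕ} {D : List DrawnEdge} (c : GridPoint × GridPoint → List Bool) {e q t : ℕ}
    (he : e < D.length) (hq : q + 1 < (D[e]).2.2.length) :
    scaledPieceAt k D c e q t = boolPair (c (scaledEdge k (D[e]).2.2 q t)) [] := by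
  rw [scaledPieceAt, List.getElem?_eq_getElem he]
  simp only [hq, ↓reduceIte, boolPair_eq, List.append_nil]

/-- The flat piece of family A out of range is empty. [folklore] -/
theorem scaledPieceAt_of_not_range {k : ℕ} {D : List DrawnEdge} (c : GridPoint × GridPoint → List Bool) {e q t : ℕ}
    (h : ¬ ∃ he : e < D.length, q + 1 < (D[e]).2.2.length) : scaledPieceAt k D c e q t = [] := by
  rw [scaledPieceAt]
  by_cases he : e < D.length
  · rw [List.getElem?_eq_getElem he]
    simp only
    rw [if_neg (fun hq => h ⟨he, hq⟩)]
  · rw [List.getElem?_eq_none (not_lt.mp he)]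

/-- The scaled edge through `getElem`, in range. [folklore] -/
theorem scaledEdge_eq (k : ℕ) {π : List GridPoint} {q : ℕ} (hq : q + 1 < π.length) (t : ℕ) :
    scaledEdge k π q t = (runPt k (π[q]) (π[q + 1] - π[q]) t, runPt k (π[q]) (π[q + 1] - π[q]) (t + 1)) := by
  rw [scaledEdge, List.getD_eq_getElem _ _ (Nat.lt_of_succ_lt hq), List.getD_eq_getElem _ _ hq]

/-- **The piece function of family A computes the flat pieces**: on the argument `⟨ctx, 1ⁱ⟩` of a
presentation `(P, D, s, t)`, with `Λ` and the translation `v` in the context,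
`pieceAF` returns `scaledPieceFlat k Λ D (cV v) i` (`k = squaresK N`) — for every `i`.
[cite: LiskiewiczOgiharaToda2003, §4 (proof of Theorem 7, E₃)] -/
theorem pieceAF_argOf (P : List GridPoint) (D : List DrawnEdge) (s t Λ : ℕ) (v : GridPoint) (i : ℕ) :
    pieceAF (argOf P D s t Λ v i) = scaledPieceFlat (squaresK P.length) Λ D (cV v) i := by
  rw [pieceAF, iteFn_of_oneBit oneBit_rangeAF, scaledPieceFlat_eq]
  by_cases hr : rangeAF (argOf P D s t Λ v i) = [true]
  · obtain ⟨he, hq⟩ := (rangeAF_argOf_eq_true_iff P s t v D Λ i).mp hr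
    have hue := ueAF_argOf P D s t Λ v i
    have hpa : paAF (argOf P D s t Λ v i) = encPt _ := ptG_argOf P s t v hue he (uqAF_argOf P D s t Λ v i) (by omega)
    have hpb : pbAF (argOf P D s t Λ v i) = encPt _ :=
      ptG_argOf P s t v hue he (q := idxAQ (squaresK P.length) Λ i + 1)
        (by rw [Function.comp_apply, uqAF_argOf, ← Com.ones_succ]) hq
    rw [if_pos hr, scaledPieceAt_of_range _ he hq, fanoutFn_apply, edgeAF, fanoutFn_apply,
      runPtG_argOf P D s t Λ v i hpa hpb (utAF_argOf P D s t Λ v i),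
      runPtG_argOf P D s t Λ v i hpa hpb (c := idxAT (squaresK P.length) Λ i + 1)
        (by rw [Function.comp_apply, utAF_argOf, ← Com.ones_succ]),
      cV_eq, scaledEdge_eq _ hq]
  · rw [if_neg hr, scaledPieceAt_of_not_range _ (fun h => hr ((rangeAF_argOf_eq_true_iff P s t v D Λ i).mpr h))]

/-! ### Family B: the piece function of the squares -/

/-- The code of `π_e[0]` (family B). [folklore] -/
def p0BF : List Bool → List Bool := ptG ueBF fun _ => []
/-- The code of `π_e[1]` (family B). [folklore] -/
def p1BF : List Bool → List Bool := ptG ueBF fun _ => [true]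
/-- `1^{2j+2}`: the column of the first foot of the `j`-th square. [cite: LiskiewiczOgiharaToda2003, §4 (proof of Theorem 7, E₃: "β unit-size squares with a gap of unit length in between")] -/
def ucBF : List Bool → List Bool := appF ∘ fanoutFn (appF ∘ fanoutFn ujBF ujBF) fun _ => [true, true]
/-- `1^{2j+3}`: the column of the second foot. [folklore] -/
def ucB'F : List Bool → List Bool := List.cons true ∘ ucBF
/-- The translated first foot `p`. [folklore] -/
def fpBF : List Bool → List Bool := runPtG p0BF p1BF ucBF
/-- The translated second foot `q`. [folklore] -/
def fqBF : List Bool → List Bool := runPtG p0BF p1BF ucB'F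
/-- The translated first corner `p′`. [folklore] -/
def cpBF : List Bool → List Bool := cornerPtG p0BF p1BF ucBF
/-- The translated second corner `q′`. [folklore] -/
def cqBF : List Bool → List Bool := cornerPtG p0BF p1BF ucB'F
/-- The code of the `m`-th new edge of the square: `p p′` (`m = 0`), `p′ q′` (`m = 1`), `q′ q`
(`m = 2`). [cite: LiskiewiczOgiharaToda2003, §4 (proof of Theorem 7, E₃, Fig. 8)] -/
def edgeBF : List Bool → List Bool :=
  iteFn (isNilFn ∘ umBF) (fanoutFn fpBF cpBF)
    (iteFn (ltLenF ∘ fanoutFn umBF fun _ => ones 2) (fanoutFn cpBF cqBF) (fanoutFn cqBF fqBF))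
/-- **The piece function of family B**: the frame of the `m`-th new edge of the `j`-th square of
`D[e]`, or nothing when `e ≥ |D|`. [cite: LiskiewiczOgiharaToda2003, §4 (proof of Theorem 7: R₁ emits E₃, the squares)] -/
def pieceBF : List Bool → List Bool := iteFn c1BF (fanoutFn edgeBF fun _ => []) fun _ => []

/-- `p0BF ∈ FP`. [folklore] -/
theorem p0BF_mem_FP : p0BF ∈ FP := ptG_mem_FP ueBF_mem_FP (const_mem_FP _)
/-- `p1BF ∈ FP`. [folklore] -/
theorem p1BF_mem_FP : p1BF ∈ FP := ptG_mem_FP ueBF_mem_FP (const_mem_FP _)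
/-- `ucBF ∈ FP`. [folklore] -/
theorem ucBF_mem_FP : ucBF ∈ FP :=
  comp_mem_FP appF_mem_FP (fanoutFn_mem_FP (comp_mem_FP appF_mem_FP (fanoutFn_mem_FP ujBF_mem_FP ujBF_mem_FP)) (const_mem_FP _))
/-- `ucB'F ∈ FP`. [folklore] -/
theorem ucB'F_mem_FP : ucB'F ∈ FP := comp_mem_FP (cons_mem_FP true) ucBF_mem_FP
/-- `fpBF ∈ FP`. [folklore] -/
theorem fpBF_mem_FP : fpBF ∈ FP := runPtG_mem_FP p0BF_mem_FP p1BF_mem_FP ucBF_mem_FP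
/-- `fqBF ∈ FP`. [folklore] -/
theorem fqBF_mem_FP : fqBF ∈ FP := runPtG_mem_FP p0BF_mem_FP p1BF_mem_FP ucB'F_mem_FP
/-- `cpBF ∈ FP`. [folklore] -/
theorem cpBF_mem_FP : cpBF ∈ FP := cornerPtG_mem_FP p0BF_mem_FP p1BF_mem_FP ucBF_mem_FP
/-- `cqBF ∈ FP`. [folklore] -/
theorem cqBF_mem_FP : cqBF ∈ FP := cornerPtG_mem_FP p0BF_mem_FP p1BF_mem_FP ucB'F_mem_FP
/-- `edgeBF ∈ FP`. [folklore] -/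
theorem edgeBF_mem_FP : edgeBF ∈ FP :=
  iteFn_mem_FP (comp_mem_FP isNilFn_mem_FP umBF_mem_FP) (fanoutFn_mem_FP fpBF_mem_FP cpBF_mem_FP)
    (iteFn_mem_FP (comp_mem_FP ltLenF_mem_FP (fanoutFn_mem_FP umBF_mem_FP (const_mem_FP _)))
      (fanoutFn_mem_FP cpBF_mem_FP cqBF_mem_FP) (fanoutFn_mem_FP cqBF_mem_FP fqBF_mem_FP))
/-- **`pieceBF ∈ FP`.** [cite: AroraBarak2009, §1.3 (closure of polynomial time under composition)] -/
theorem pieceBF_mem_FP : pieceBF ∈ FP :=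
  iteFn_mem_FP c1BF_mem_FP (fanoutFn_mem_FP edgeBF_mem_FP (const_mem_FP _)) (const_mem_FP _)

/-- The run point `c` of the first unit step of a drawn edge (base `π[0]`, direction `π[1] - π[0]`,
read with `getD`). [folklore] -/
def sqRunPt (k : ℕ) (d : DrawnEdge) (c : ℕ) : GridPoint :=
  runPt k (d.2.2.getD 0 0) (d.2.2.getD 1 0 - d.2.2.getD 0 0) c
/-- The corner beside it. [folklore] -/
def sqCorner (k : ℕ) (d : DrawnEdge) (c : ℕ) : GridPoint :=
  cornerOf k (d.2.2.getD 0 0) (d.2.2.getD 1 0 - d.2.2.getD 0 0) c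

/-- **The `j`-th square of a drawn edge with at least two points**, through `getD`: feet the run
points `2j + 2`, `2j + 3` of the first unit step, corners beside them. [folklore] -/
theorem sqSite_eq (k : ℕ) {d : DrawnEdge} (h2 : 2 ≤ d.2.2.length) (j : ℕ) :
    sqSite k d j = ⟨sqRunPt k d (2 * j + 2), sqRunPt k d (2 * j + 3), sqCorner k d (2 * j + 2), sqCorner k d (2 * j + 3)⟩ := by
  obtain ⟨p, q, l, hπ⟩ : ∃ p q l, d.2.2 = p :: q :: l := by
    match h : d.2.2, h2 with
    | p :: q :: l, _ => exact ⟨p, q, l, rfl⟩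
  simp [sqSite, sqRunPt, sqCorner, hπ, firstStep]

/-- The `m`-th new edge of a square, `m < 3`. [folklore] -/
def sqEdge (S : SquareSite) (m : ℕ) : GridPoint × GridPoint :=
  if m = 0 then (S.p, S.p') else if m = 1 then (S.p', S.q') else (S.q', S.q)

/-- The new edges of a square by position. [folklore] -/
theorem getElem?_edges (S : SquareSite) {m : ℕ} (hm : m < 3) : (S.edges)[m]? = some (sqEdge S m) := by
  unfold SquareSite.edges sqEdge
  interval_cases m <;> rfl

/-- The flat piece of family B in closed form, in range. [folklore] -/
theorem squarePieceAt_of_lt {k : ℕ} {D : List DrawnEdge} (c : GridPoint × GridPoint → List Bool) {e j m : ℕ}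
    (he : e < D.length) (hm : m < 3) :
    squarePieceAt k D c e j m = boolPair (c (sqEdge (sqSite k (D[e]) j) m)) [] := by
  rw [squarePieceAt, List.getElem?_eq_getElem he]
  simp only [getElem?_edges _ hm, boolPair_eq, List.append_nil]

/-- The `m`-th new edge of the `j`-th square of a drawn edge with at least two points, in
closed form. [folklore] -/
theorem sqEdge_sqSite (k : ℕ) {d : DrawnEdge} (h2 : 2 ≤ d.2.2.length) (j m : ℕ) :
    sqEdge (sqSite k d j) m =
      if m = 0 then (sqRunPt k d (2 * j + 2), sqCorner k d (2 * j + 2))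
      else if m = 1 then (sqCorner k d (2 * j + 2), sqCorner k d (2 * j + 3))
      else (sqCorner k d (2 * j + 3), sqRunPt k d (2 * j + 3)) := by
  rw [sqSite_eq k h2]; rfl

/-- The flat piece of family B out of range is empty. [folklore] -/
theorem squarePieceAt_of_le {k : ℕ} {D : List DrawnEdge} (c : GridPoint × GridPoint → List Bool) {e j m : ℕ}
    (he : D.length ≤ e) : squarePieceAt k D c e j m = [] := by
  rw [squarePieceAt, List.getElem?_eq_none he]

section PieceB

variable (P : List GridPoint) {D : List DrawnEdge} (s t Λ : ℕ) (v : GridPoint) (i : ℕ)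

/-- Value of `ucBF`, `ucB'F` on the piece argument of a presentation. [folklore] -/
theorem ucBF_argOf (D : List DrawnEdge) :
    ucBF (argOf P D s t Λ v i) = ones (2 * idxBJ (squaresBeta P.length) i + 2) ∧
      ucB'F (argOf P D s t Λ v i) = ones (2 * idxBJ (squaresBeta P.length) i + 3) := by
  have h : ucBF (argOf P D s t Λ v i) = ones (2 * idxBJ (squaresBeta P.length) i + 2) := by
    rw [ucBF, Function.comp_apply, fanoutFn_apply, Function.comp_apply, fanoutFn_apply, ujBF_argOf, appF_boolPair,
      appF_boolPair, show [true, true] = ones 2 from rfl, Com.ones_append, Com.ones_append, two_mul]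
  exact ⟨h, by rw [ucB'F, Function.comp_apply, h, ← Com.ones_succ]⟩

/-- **The piece function of family B computes the flat pieces**: on the argument `⟨ctx, 1ⁱ⟩` of a
presentation `(P, D, s, t)` all of whose drawn paths have at least two points (true for a valid
drawing), `pieceBF` returns `squarePieceFlat k β D (cV v) i` (`k = squaresK N`, `β = squaresBeta N`)
— for every `i`. [cite: LiskiewiczOgiharaToda2003, §4 (proof of Theorem 7, E₃: the β squares of every edge)] -/
theorem pieceBF_argOf (h2 : ∀ d ∈ D, 2 ≤ d.2.2.length) :
    pieceBF (argOf P D s t Λ v i) = squarePieceFlat (squaresK P.length) (squaresBeta P.length) D (cV v) i := by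
  rw [pieceBF, iteFn_of_oneBit oneBit_c1BF, squarePieceFlat_eq, c1BF_argOf]
  by_cases he : idxBE (squaresBeta P.length) i < D.length
  · -- names and the fetched data
    have hd2 : 2 ≤ (D[idxBE (squaresBeta P.length) i]).2.2.length := h2 _ (List.getElem_mem he)
    have hue := ueBF_argOf P D s t Λ v i
    have hq0 : (fun _ : List Bool => ([] : List Bool)) (argOf P D s t Λ v i) = ones 0 := rfl
    have hq1 : (fun _ : List Bool => [true]) (argOf P D s t Λ v i) = ones 1 := rfl
    have hp0 : p0BF (argOf P D s t Λ v i) = encPt ((D[idxBE (squaresBeta P.length) i]).2.2[0]) :=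
      ptG_argOf (ue := ueBF) (uq := fun _ => []) P s t v hue he hq0 (by omega)
    have hp1 : p1BF (argOf P D s t Λ v i) = encPt ((D[idxBE (squaresBeta P.length) i]).2.2[1]) :=
      ptG_argOf (ue := ueBF) (uq := fun _ => [true]) P s t v hue he hq1 (by omega)
    obtain ⟨huc, huc'⟩ := ucBF_argOf P s t Λ v i D
    have e0 : (D[idxBE (squaresBeta P.length) i]).2.2.getD 0 0 = (D[idxBE (squaresBeta P.length) i]).2.2[0] :=
      List.getD_eq_getElem _ _ (by omega)
    have e1 : (D[idxBE (squaresBeta P.length) i]).2.2.getD 1 0 = (D[idxBE (squaresBeta P.length) i]).2.2[1] :=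
      List.getD_eq_getElem _ _ (by omega)
    have hfp : fpBF (argOf P D s t Λ v i) = _ := runPtG_argOf P D s t Λ v i hp0 hp1 huc
    have hfq : fqBF (argOf P D s t Λ v i) = _ := runPtG_argOf P D s t Λ v i hp0 hp1 huc'
    have hcp : cpBF (argOf P D s t Λ v i) = _ := cornerPtG_argOf P D s t Λ v i hp0 hp1 huc
    have hcq : cqBF (argOf P D s t Λ v i) = _ := cornerPtG_argOf P D s t Λ v i hp0 hp1 huc'
    have hum : umBF (argOf P D s t Λ v i) = ones (idxBM (squaresBeta P.length) i) := umBF_argOf P D s t Λ v i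
    have hm3 : idxBM (squaresBeta P.length) i < 3 := idxBM_lt _ _
    rw [if_pos (by simp [he]), squarePieceAt_of_lt _ he hm3, fanoutFn_apply, cV_eq, sqEdge_sqSite _ hd2, edgeBF]
    by_cases hm0 : idxBM (squaresBeta P.length) i = 0
    · have hc0 : (isNilFn ∘ umBF) (argOf P D s t Λ v i) = [true] := by
        rw [Function.comp_apply, hum, hm0]; simp [isNilFn, ones]
      rw [iteFn_apply_true hc0, fanoutFn_apply, hfp, hcp, if_pos hm0]
      simp only [sqRunPt, sqCorner, e0, e1]
    · have hc0 : (isNilFn ∘ umBF) (argOf P D s t Λ v i) = [false] := by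
        rw [Function.comp_apply, hum]; simp [isNilFn, ones, List.replicate_eq_nil_iff, hm0]
      rw [iteFn_apply_false hc0, if_neg hm0]
      by_cases hm1 : idxBM (squaresBeta P.length) i = 1
      · have hc1 : (ltLenF ∘ fanoutFn umBF fun _ => ones 2) (argOf P D s t Λ v i) = [true] := by
          rw [Function.comp_apply, fanoutFn_apply, hum, ltLenF_ones, hm1]; rfl
        rw [iteFn_apply_true hc1, fanoutFn_apply, hcp, hcq, if_pos hm1]
        simp only [sqCorner, e0, e1]
      · have hm2 : idxBM (squaresBeta P.length) i = 2 := by omega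
        have hc1 : (ltLenF ∘ fanoutFn umBF fun _ => ones 2) (argOf P D s t Λ v i) = [false] := by
          rw [Function.comp_apply, fanoutFn_apply, hum, ltLenF_ones, hm2]; rfl
        rw [iteFn_apply_false hc1, fanoutFn_apply, hcq, hfq, if_neg hm1]
        simp only [sqRunPt, sqCorner, e0, e1]
  · rw [if_neg (by simp [he]), squarePieceAt_of_le _ (not_lt.mp he)]

end PieceB

/-! ### The size of the pieces on the generator's own trajectory -/

/-- `k = 2N² + 5 < 2^{2N+3}`. [folklore] -/
theorem squaresK_lt_two_pow (N : ℕ) : squaresK N < 2 ^ (2 * N + 3) := by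
  have h := Nat.lt_two_pow_self (n := N)
  have h2 : N * N < 2 ^ N * 2 ^ N := Nat.mul_lt_mul'' h h
  rw [← pow_add, ← two_mul] at h2
  have h8 : 2 ^ (2 * N + 3) = 2 ^ (2 * N) * 8 := by rw [pow_add]; norm_num
  unfold squaresK squaresBeta
  omega

/-- `k ≤ 5 (N + 1)²`. [folklore] -/
theorem squaresK_le (N : ℕ) : squaresK N ≤ 5 * ((N + 1) * (N + 1)) := by
  unfold squaresK squaresBeta; nlinarith

/-- `N = |P| ≤ |code|`. [folklore] -/
theorem length_P_le (P : List GridPoint) (D : List DrawnEdge) (s t : ℕ) :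
    P.length ≤ (encodingDrawnGraphInstance.encode (P, D, s, t)).length := by
  rw [encDG_eq, length_boolPair, encPL_eq, length_boolPair]; simp [ones]; omega

/-- A coordinate of a translated run point or corner: `|k a + c u + e + w| ≤ k (|a| + 1) + |w| + 1`
for `c ≤ k`, `|u| ≤ 1`, `|e| ≤ 1`. [folklore] -/
theorem natAbs_affine_le {k c : ℕ} {a u e w : ℤ} (hc : c ≤ k) (hu : u.natAbs ≤ 1) (he : e.natAbs ≤ 1) :
    ((k : ℤ) * a + c * u + e + w).natAbs ≤ k * (a.natAbs + 1) + w.natAbs + 1 := by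
  have e1 : ((k : ℤ) * a).natAbs = k * a.natAbs := by rw [Int.natAbs_mul]; simp
  have e2 : ((c : ℤ) * u).natAbs ≤ k := by
    rw [Int.natAbs_mul, Int.natAbs_natCast]; exact (Nat.mul_le_mul hc hu).trans (by omega)
  calc ((k : ℤ) * a + c * u + e + w).natAbs
      ≤ ((k : ℤ) * a + c * u + e).natAbs + w.natAbs := Int.natAbs_add_le _ _
    _ ≤ (((k : ℤ) * a + c * u).natAbs + e.natAbs) + w.natAbs := by gcongr; exact Int.natAbs_add_le _ _
    _ ≤ ((((k : ℤ) * a).natAbs + ((c : ℤ) * u).natAbs) + e.natAbs) + w.natAbs := by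
        gcongr; exact Int.natAbs_add_le _ _
    _ ≤ k * (a.natAbs + 1) + w.natAbs + 1 := by rw [e1]; nlinarith

/-- Size of a bounded coordinate: `X ≤ k (A + 1) + W + 1 < 2^{3n+4}` for `k < 2^{2n+3}` and
`A, W < 2^n`. [folklore] -/
theorem size_coordK_le {k A W n X : ℕ} (hk : k < 2 ^ (2 * n + 3)) (hA : A.size ≤ n) (hW : W.size ≤ n)
    (hX : X ≤ k * (A + 1) + W + 1) : X.size ≤ 3 * n + 4 := by
  rw [Nat.size_le] at hA hW ⊢
  have h1 : k * (A + 1) ≤ k * 2 ^ n := Nat.mul_le_mul_left k hA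
  have h2 : k * 2 ^ n < 2 ^ (2 * n + 3) * 2 ^ n := Nat.mul_lt_mul_of_pos_right hk (by positivity)
  rw [← pow_add] at h2
  have h4 : 2 ^ (2 * n + 3 + n) + 2 ^ n ≤ 2 ^ (3 * n + 4) := by
    have : 2 ^ n ≤ 2 ^ (2 * n + 3 + n) := Nat.pow_le_pow_right (by norm_num) (by omega)
    calc 2 ^ (2 * n + 3 + n) + 2 ^ n ≤ 2 ^ (2 * n + 3 + n) + 2 ^ (2 * n + 3 + n) := by omega
      _ = 2 ^ (3 * n + 4) := by rw [← two_mul, ← pow_succ']; congr 1; omega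
  omega

/-- The code of a translated point with bounded coordinates is short. [folklore] -/
theorem length_encPt_le_of_coords {n k : ℕ} {X a v : GridPoint} (hk : k < 2 ^ (2 * n + 3))
    (ha : a.1.natAbs.size ≤ n ∧ a.2.natAbs.size ≤ n) (hv : v.1.natAbs.size ≤ n ∧ v.2.natAbs.size ≤ n)
    (h1 : X.1.natAbs ≤ k * (a.1.natAbs + 1) + v.1.natAbs + 1)
    (h2 : X.2.natAbs ≤ k * (a.2.natAbs + 1) + v.2.natAbs + 1) :
    (encPt X).length ≤ 3 * (3 * n + 4) + 14 :=
  length_encPt_le_of_size (size_coordK_le hk ha.1 hv.1 h1) (size_coordK_le hk ha.2 hv.2 h2)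

/-- Components of a unit vector. [folklore] -/
theorem natAbs_le_of_isUnitVec {u : GridPoint} (hu : IsUnitVec u) : u.1.natAbs ≤ 1 ∧ u.2.natAbs ≤ 1 := by
  rcases IsUnitVec.cases hu with ⟨h1, h2⟩ | ⟨h1, h2⟩ | ⟨h1, h2⟩ | ⟨h1, h2⟩ <;> simp [h1, h2]

/-- Components of the side vector. [folklore] -/
theorem natAbs_sideVec_le (u : GridPoint) : (sideVec u).1.natAbs ≤ 1 ∧ (sideVec u).2.natAbs ≤ 1 := by
  unfold sideVec; split_ifs <;> simp

/-- The coordinates of a translated run point. [folklore] -/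
theorem natAbs_runPt_add_le {k c : ℕ} (hc : c ≤ k) (a : GridPoint) {u : GridPoint} (hu : IsUnitVec u) (v : GridPoint) :
    (runPt k a u c + v).1.natAbs ≤ k * (a.1.natAbs + 1) + v.1.natAbs + 1 ∧
      (runPt k a u c + v).2.natAbs ≤ k * (a.2.natAbs + 1) + v.2.natAbs + 1 := by
  obtain ⟨hu1, hu2⟩ := natAbs_le_of_isUnitVec hu
  constructor
  · rw [Prod.fst_add, runPt_fst, show (k : ℤ) * a.1 + c * u.1 + v.1 = (k : ℤ) * a.1 + c * u.1 + 0 + v.1 by ring]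
    exact natAbs_affine_le hc hu1 (by simp)
  · rw [Prod.snd_add, runPt_snd, show (k : ℤ) * a.2 + c * u.2 + v.2 = (k : ℤ) * a.2 + c * u.2 + 0 + v.2 by ring]
    exact natAbs_affine_le hc hu2 (by simp)

/-- The coordinates of a translated corner. [folklore] -/
theorem natAbs_cornerOf_add_le {k c : ℕ} (hc : c ≤ k) (a : GridPoint) {u : GridPoint} (hu : IsUnitVec u) (v : GridPoint) :
    (cornerOf k a u c + v).1.natAbs ≤ k * (a.1.natAbs + 1) + v.1.natAbs + 1 ∧
      (cornerOf k a u c + v).2.natAbs ≤ k * (a.2.natAbs + 1) + v.2.natAbs + 1 := by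
  obtain ⟨hu1, hu2⟩ := natAbs_le_of_isUnitVec hu
  obtain ⟨hs1, hs2⟩ := natAbs_sideVec_le u
  constructor
  · rw [cornerOf, Prod.fst_add, Prod.fst_add, runPt_fst]
    exact natAbs_affine_le hc hu1 hs1
  · rw [cornerOf, Prod.snd_add, Prod.snd_add, runPt_snd]
    exact natAbs_affine_le hc hu2 hs2

section Sizes

variable (P : List GridPoint) {D : List DrawnEdge} (s t Λ : ℕ) (v : GridPoint)

/-- The data every size estimate uses, read off the context: with `n = |ctx|`, `k < 2^{2n+3}`,
the translation has coordinates of size `≤ n`, and so has every point of every drawn path.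
[folklore] -/
theorem ctx_sizes :
    squaresK P.length < 2 ^ (2 * (ctx (encodingDrawnGraphInstance.encode (P, D, s, t)) Λ v).length + 3) ∧
    (v.1.natAbs.size ≤ (ctx (encodingDrawnGraphInstance.encode (P, D, s, t)) Λ v).length ∧
      v.2.natAbs.size ≤ (ctx (encodingDrawnGraphInstance.encode (P, D, s, t)) Λ v).length) ∧
    ∀ d ∈ D, ∀ p ∈ d.2.2, (p.1.natAbs.size ≤ (ctx (encodingDrawnGraphInstance.encode (P, D, s, t)) Λ v).length ∧
      p.2.natAbs.size ≤ (ctx (encodingDrawnGraphInstance.encode (P, D, s, t)) Λ v).length) := by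
  set w := encodingDrawnGraphInstance.encode (P, D, s, t) with hw
  have hw_ctx : w.length ≤ (ctx w Λ v).length := by rw [ctx, length_boolPair]; omega
  have hv_ctx : (dpEnc v.1).length ≤ (ctx w Λ v).length ∧ (dpEnc v.2).length ≤ (ctx w Λ v).length := by
    rw [ctx, length_boolPair, length_boolPair, length_boolPair]; omega
  refine ⟨?_, ⟨(size_natAbs_le_length_dpEnc _).trans hv_ctx.1, (size_natAbs_le_length_dpEnc _).trans hv_ctx.2⟩,
    fun d hd p hp => ?_⟩
  · have hN : P.length ≤ (ctx w Λ v).length := (length_P_le P D s t).trans hw_ctx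
    exact lt_of_lt_of_le (squaresK_lt_two_pow P.length) (Nat.pow_le_pow_right (by norm_num) (by omega))
  · have hpt := length_encPt_le P s t hd hp
    have hsz := size_natAbs_le_length_encPt p
    exact ⟨hsz.1.trans (hpt.trans hw_ctx), hsz.2.trans (hpt.trans hw_ctx)⟩

/-- One framed unit edge of a scaled path is short. [folklore] -/
theorem length_scaledPiece_le (hch : ∀ d ∈ D, List.IsChain IsGridEdge d.2.2) {d : DrawnEdge} (hdD : d ∈ D)
    {q : ℕ} (hq : q + 1 < d.2.2.length) {tt : ℕ} (htk : tt < squaresK P.length) :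
    (boolPair (cV v (scaledEdge (squaresK P.length) d.2.2 q tt)) []).length ≤
      pieceClip * ((ctx (encodingDrawnGraphInstance.encode (P, D, s, t)) Λ v).length + 1) := by
  obtain ⟨hk, hv, hpts⟩ := ctx_sizes P s t Λ v (D := D)
  rw [scaledEdge_eq _ hq, cV_eq, length_boolPair, length_boolPair, List.length_nil]
  have hu : IsUnitVec (d.2.2[q + 1] - d.2.2[q]) := isUnitVec_step (hch d hdD) hq
  have ha := hpts d hdD _ (List.getElem_mem (Nat.lt_of_succ_lt hq))
  have k1 := length_encPt_le_of_coords hk ha hv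
    (natAbs_runPt_add_le htk.le (d.2.2[q]) hu v).1 (natAbs_runPt_add_le htk.le (d.2.2[q]) hu v).2
  have k2 := length_encPt_le_of_coords hk ha hv
    (natAbs_runPt_add_le (show tt + 1 ≤ squaresK P.length by omega) (d.2.2[q]) hu v).1
    (natAbs_runPt_add_le (show tt + 1 ≤ squaresK P.length by omega) (d.2.2[q]) hu v).2
  simp only [pieceClip]
  omega

/-- **The pieces of family A are short on the generator's trajectory**: for a presentation whose
drawn paths are grid chains, every piece has at most `pieceClip · (|ctx| + 1)` symbols.
[folklore] -/
theorem length_pieceAF_argOf_le (hch : ∀ d ∈ D, List.IsChain IsGridEdge d.2.2) (i : ℕ) :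
    (pieceAF (argOf P D s t Λ v i)).length ≤
      pieceClip * ((ctx (encodingDrawnGraphInstance.encode (P, D, s, t)) Λ v).length + 1) := by
  rw [pieceAF_argOf, scaledPieceFlat_eq]
  by_cases hr : ∃ he : idxAE (squaresK P.length) Λ i < D.length,
      idxAQ (squaresK P.length) Λ i + 1 < (D[idxAE (squaresK P.length) Λ i]).2.2.length
  · obtain ⟨he, hq⟩ := hr
    rw [scaledPieceAt_of_range _ he hq]
    have hkpos : 0 < squaresK P.length := by unfold squaresK; omega
    exact length_scaledPiece_le P s t Λ v hch (List.getElem_mem he) hq (Nat.mod_lt _ hkpos)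
  · rw [scaledPieceAt_of_not_range _ hr]
    simp

/-- `j < β` for the square index of a position. [folklore] -/
theorem idxBJ_lt {β : ℕ} (hβ : 0 < β) (i : ℕ) : idxBJ β i < β := by
  unfold idxBJ
  have h : i % (β * 3) < 3 * β := by rw [Nat.mul_comm]; exact Nat.mod_lt _ (by omega)
  exact Nat.div_lt_of_lt_mul h

/-- One framed new edge of a square is short. [folklore] -/
theorem length_squarePiece_le (hD : IsGridDrawing P D) {d : DrawnEdge} (hdD : d ∈ D) {j : ℕ}
    (hj : j < squaresBeta P.length) (m : ℕ) :
    (boolPair (cV v (sqEdge (sqSite (squaresK P.length) d j) m)) []).length ≤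
      pieceClip * ((ctx (encodingDrawnGraphInstance.encode (P, D, s, t)) Λ v).length + 1) := by
  obtain ⟨hk, hv, hpts⟩ := ctx_sizes P s t Λ v (D := D)
  obtain ⟨p, q, l, hπ⟩ := exists_eq_cons_cons_of_mem hD hdD
  have hd2 : 2 ≤ d.2.2.length := by rw [hπ]; simp
  have hch : List.IsChain IsGridEdge (p :: q :: l) := hπ ▸ (hD.2.1 d hdD).2.2.2.2.2.2.1
  have hu : IsUnitVec (q - p) := (isGridEdge_iff_isUnitVec _ _).1 (List.isChain_cons_cons.mp hch).1
  have ha := hpts d hdD p (by rw [hπ]; simp)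
  have hc2 : 2 * j + 2 ≤ squaresK P.length := by unfold squaresK; omega
  have hc3 : 2 * j + 3 ≤ squaresK P.length := by unfold squaresK; omega
  have kp2 := length_encPt_le_of_coords hk ha hv (natAbs_runPt_add_le hc2 p hu v).1 (natAbs_runPt_add_le hc2 p hu v).2
  have kp3 := length_encPt_le_of_coords hk ha hv (natAbs_runPt_add_le hc3 p hu v).1 (natAbs_runPt_add_le hc3 p hu v).2
  have kc2 := length_encPt_le_of_coords hk ha hv (natAbs_cornerOf_add_le hc2 p hu v).1
    (natAbs_cornerOf_add_le hc2 p hu v).2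
  have kc3 := length_encPt_le_of_coords hk ha hv (natAbs_cornerOf_add_le hc3 p hu v).1
    (natAbs_cornerOf_add_le hc3 p hu v).2
  rw [sqEdge_sqSite _ hd2, cV_eq, length_boolPair, List.length_nil]
  simp only [sqRunPt, sqCorner, hπ, List.getD_cons_zero, List.getD_cons_succ, pieceClip]
  split_ifs <;> simp only [length_boolPair] <;> omega

/-- **The pieces of family B are short on the generator's trajectory** (valid drawing). [folklore] -/
theorem length_pieceBF_argOf_le (hD : IsGridDrawing P D) (i : ℕ) :
    (pieceBF (argOf P D s t Λ v i)).length ≤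
      pieceClip * ((ctx (encodingDrawnGraphInstance.encode (P, D, s, t)) Λ v).length + 1) := by
  rw [pieceBF_argOf P s t Λ v i (two_le_length_of_mem hD), squarePieceFlat_eq]
  by_cases he : idxBE (squaresBeta P.length) i < D.length
  · rw [squarePieceAt_of_lt _ he (idxBM_lt _ _)]
    exact length_squarePiece_le P s t Λ v hD (List.getElem_mem he) (idxBJ_lt (by unfold squaresBeta; omega) i) _
  · rw [squarePieceAt_of_le _ (not_lt.mp he)]
    simp

end Sizes

/-! ### The items generator: folding the clipped pieces of the two families -/

/-- The round polynomial of family A: `5 (X + 1)⁴ ≥ |D| · Λ · k`. [folklore] -/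
def sqPolyA : Polynomial ℕ := 5 * (X + 1) ^ 4
/-- The round polynomial of family B: `3 (X + 1)³ ≥ |D| · β · 3`. [folklore] -/
def sqPolyB : Polynomial ℕ := 3 * (X + 1) ^ 3

/-- Evaluation of `sqPolyA`. [folklore] -/
@[simp] theorem sqPolyA_eval (n : ℕ) : sqPolyA.eval n = 5 * (n + 1) ^ 4 := by simp [sqPolyA]
/-- Evaluation of `sqPolyB`. [folklore] -/
@[simp] theorem sqPolyB_eval (n : ℕ) : sqPolyB.eval n = 3 * (n + 1) ^ 3 := by simp [sqPolyB]

/-- The initial record of a fold with round polynomial `p`: `⟨ctx, ⟨bin (p |ctx|), ⟨1⁰, ε⟩⟩⟩`.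
[folklore] -/
def genInitG (p : Polynomial ℕ) : List Bool → List Bool :=
  fanoutFn (fun x => x) (fanoutFn (HashBricks.popCountFn ∘ Plumb.polyFn p) fun _ => boolPair [] [])
/-- **The generator of family A**: fold the clipped piece function over `sqPolyA |ctx|` positions.
[cite: LiskiewiczOgiharaToda2003, §4 (proof of Theorem 7: R₁ computes E₃, the scaled paths)] -/
def genAFn : List Bool → List Bool := sndPow 2 ∘ foldLoop appF (clipF pieceClip pieceAF) sqPolyA ∘ genInitG sqPolyA
/-- **The generator of family B.** [cite: LiskiewiczOgiharaToda2003, §4 (proof of Theorem 7: R₁ computes E₃, the squares)] -/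
def genBFn : List Bool → List Bool := sndPow 2 ∘ foldLoop appF (clipF pieceClip pieceBF) sqPolyB ∘ genInitG sqPolyB
/-- **The items generator of the squares step**: family A, then family B.
[cite: LiskiewiczOgiharaToda2003, §4 (proof of Theorem 7: R₁(x) = (E₃, …))] -/
def genSqItemsFn : List Bool → List Bool := appF ∘ fanoutFn genAFn genBFn

/-- `genInitG p ∈ FP`. [folklore] -/
theorem genInitG_mem_FP (p : Polynomial ℕ) : genInitG p ∈ FP :=
  fanoutFn_mem_FP (PolyTimeComputable.id _) (fanoutFn_mem_FP
    (comp_mem_FP HashBricks.popCountFn_mem_FP (Plumb.polyFn_mem_FP p)) (const_mem_FP _))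
/-- **`genAFn ∈ FP`** (the clipped fold of `FoldBricks.lean`). [cite: AroraBarak2009, §1.3 (bounded loops)] -/
theorem genAFn_mem_FP : genAFn ∈ FP :=
  comp_mem_FP (sndPow_mem_FP 2) (comp_mem_FP
    (foldLoop_clipF_mem_FP pieceClip appF_mem_FP length_appF_le pieceAF_mem_FP sqPolyA) (genInitG_mem_FP _))
/-- **`genBFn ∈ FP`.** [cite: AroraBarak2009, §1.3 (bounded loops)] -/
theorem genBFn_mem_FP : genBFn ∈ FP :=
  comp_mem_FP (sndPow_mem_FP 2) (comp_mem_FP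
    (foldLoop_clipF_mem_FP pieceClip appF_mem_FP length_appF_le pieceBF_mem_FP sqPolyB) (genInitG_mem_FP _))
/-- **`genSqItemsFn ∈ FP`.** [cite: AroraBarak2009, §1.3 (closure of polynomial time under composition)] -/
theorem genSqItemsFn_mem_FP : genSqItemsFn ∈ FP :=
  comp_mem_FP appF_mem_FP (fanoutFn_mem_FP genAFn_mem_FP genBFn_mem_FP)

/-- Value of `genInitG`. [folklore] -/
theorem genInitG_apply (p : Polynomial ℕ) (x : List Bool) :
    genInitG p x = boolPair x (boolPair (encodeNat (p.eval x.length)) (boolPair (ones 0) [])) := by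
  simp [genInitG, ones]

/-- Past the last position of family A every flat piece is empty. [folklore] -/
theorem scaledPieceFlat_eq_nil_of_le {k Λ : ℕ} (hk : 0 < k) (hΛ : 1 ≤ Λ) (D : List DrawnEdge)
    (c : GridPoint × GridPoint → List Bool) {i : ℕ} (hi : scaledTotal k Λ D ≤ i) : scaledPieceFlat k Λ D c i = [] := by
  rw [scaledPieceFlat_eq, scaledPieceAt, List.getElem?_eq_none]
  rw [idxAE, Nat.le_div_iff_mul_le (Nat.mul_pos (by omega) hk)]
  exact hi

/-- Past the last position of family B every flat piece is empty. [folklore] -/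
theorem squarePieceFlat_eq_nil_of_le {k β : ℕ} (hβ : 0 < β) (D : List DrawnEdge)
    (c : GridPoint × GridPoint → List Bool) {i : ℕ} (hi : squareTotal β D ≤ i) : squarePieceFlat k β D c i = [] := by
  rw [squarePieceFlat_eq, squarePieceAt, List.getElem?_eq_none]
  rw [idxBE, Nat.le_div_iff_mul_le (Nat.mul_pos hβ (by norm_num))]
  exact hi

/-- `scaledTotal ≤ sqPolyA |ctx|`. [folklore] -/
theorem scaledTotal_le (P : List GridPoint) (D : List DrawnEdge) (s t : ℕ) {Λ : ℕ} (v : GridPoint) :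
    scaledTotal (squaresK P.length) Λ D ≤
      sqPolyA.eval (ctx (encodingDrawnGraphInstance.encode (P, D, s, t)) Λ v).length := by
  set n := (ctx (encodingDrawnGraphInstance.encode (P, D, s, t)) Λ v).length with hn
  have hΛ : Λ ≤ n := by
    rw [hn, ctx, length_boolPair, length_boolPair]; simp [ones]; omega
  have hD : D.length ≤ n := by
    rw [hn, ctx, length_boolPair, encDG_eq, length_boolPair, length_boolPair, length_boolPair]; simp [ones]; omega
  have hN : P.length ≤ n := by
    have := length_P_le P D s t
    rw [hn, ctx, length_boolPair]; omega
  have hk : squaresK P.length ≤ 5 * ((n + 1) * (n + 1)) :=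
    (squaresK_le P.length).trans (by gcongr)
  rw [sqPolyA_eval, scaledTotal]
  have e4 : (n + 1) ^ 4 = (n + 1) * (n + 1) * (n + 1) * (n + 1) := by ring
  calc D.length * (Λ * squaresK P.length)
      ≤ n * (n * (5 * ((n + 1) * (n + 1)))) := by gcongr
    _ ≤ (n + 1) * ((n + 1) * (5 * ((n + 1) * (n + 1)))) := by gcongr <;> omega
    _ = 5 * (n + 1) ^ 4 := by rw [e4]; ring

/-- `squareTotal ≤ sqPolyB |ctx|`. [folklore] -/
theorem squareTotal_le (P : List GridPoint) (D : List DrawnEdge) (s t : ℕ) (Λ : ℕ) (v : GridPoint) :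
    squareTotal (squaresBeta P.length) D ≤
      sqPolyB.eval (ctx (encodingDrawnGraphInstance.encode (P, D, s, t)) Λ v).length := by
  set n := (ctx (encodingDrawnGraphInstance.encode (P, D, s, t)) Λ v).length with hn
  have hD : D.length ≤ n := by
    rw [hn, ctx, length_boolPair, encDG_eq, length_boolPair, length_boolPair, length_boolPair]; simp [ones]; omega
  have hN : P.length ≤ n := by
    have := length_P_le P D s t
    rw [hn, ctx, length_boolPair]; omega
  have hβ : squaresBeta P.length ≤ (n + 1) * (n + 1) := by unfold squaresBeta; nlinarith
  rw [sqPolyB_eval, squareTotal]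
  have e3 : (n + 1) ^ 3 = (n + 1) * (n + 1) * (n + 1) := by ring
  calc D.length * (squaresBeta P.length * 3)
      ≤ n * ((n + 1) * (n + 1) * 3) := by gcongr
    _ ≤ (n + 1) * ((n + 1) * (n + 1) * 3) := by gcongr; omega
    _ = 3 * (n + 1) ^ 3 := by rw [e3]; ring

/-- **The generator of family A computes the family-A concatenation.** For a presentation whose
drawn paths are grid chains, with the context of its canonical code, any `Λ ≥ 1` and translation
`v`: `genAFn ctx = ccat (scaledPieceFlat k Λ D (cV v)) (scaledTotal k Λ D)`.
[cite: LiskiewiczOgiharaToda2003, §4 (proof of Theorem 7: R₁ emits the scaled paths of E₃)] -/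
theorem genAFn_ctx {P : List GridPoint} {D : List DrawnEdge} (hch : ∀ d ∈ D, List.IsChain IsGridEdge d.2.2)
    (s t : ℕ) {Λ : ℕ} (hΛ : 1 ≤ Λ) (v : GridPoint) :
    genAFn (ctx (encodingDrawnGraphInstance.encode (P, D, s, t)) Λ v) =
      ccat (scaledPieceFlat (squaresK P.length) Λ D (cV v)) (scaledTotal (squaresK P.length) Λ D) := by
  set x := ctx (encodingDrawnGraphInstance.encode (P, D, s, t)) Λ v with hx
  have hk : 0 < squaresK P.length := by unfold squaresK; omega
  rw [genAFn, Function.comp_apply, Function.comp_apply, genInitG_apply, foldLoop_apply _ _ le_rfl, sndPow]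
  simp only [Function.comp_apply, sndPow, sndF_boolPair]
  rw [foldAcc_clipF (fun j _ _ => ?_), foldAcc_appF, List.nil_append]
  · symm
    rw [← ccat_eq_ccat_of_le (scaledTotal_le P D s t v) (fun i hi => ?_)]
    · exact ccat_congr fun i _ => by rw [Nat.zero_add]; exact (pieceAF_argOf P D s t Λ v i).symm
    · exact scaledPieceFlat_eq_nil_of_le hk hΛ D _ hi
  · exact length_pieceAF_argOf_le P s t Λ v hch j

/-- **The generator of family B computes the family-B concatenation** (valid drawing). [cite: LiskiewiczOgiharaToda2003, §4 (proof of Theorem 7: R₁ emits the squares of E₃)] -/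
theorem genBFn_ctx {P : List GridPoint} {D : List DrawnEdge} (hD : IsGridDrawing P D) (s t Λ : ℕ) (v : GridPoint) :
    genBFn (ctx (encodingDrawnGraphInstance.encode (P, D, s, t)) Λ v) =
      ccat (squarePieceFlat (squaresK P.length) (squaresBeta P.length) D (cV v)) (squareTotal (squaresBeta P.length) D) := by
  set x := ctx (encodingDrawnGraphInstance.encode (P, D, s, t)) Λ v with hx
  have hβ : 0 < squaresBeta P.length := by unfold squaresBeta; omega
  rw [genBFn, Function.comp_apply, Function.comp_apply, genInitG_apply, foldLoop_apply _ _ le_rfl, sndPow]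
  simp only [Function.comp_apply, sndPow, sndF_boolPair]
  rw [foldAcc_clipF (fun j _ _ => ?_), foldAcc_appF, List.nil_append]
  · symm
    rw [← ccat_eq_ccat_of_le (squareTotal_le P D s t Λ v) (fun i hi => ?_)]
    · exact ccat_congr fun i _ => by rw [Nat.zero_add]; exact (pieceBF_argOf P s t Λ v i (two_le_length_of_mem hD)).symm
    · exact squarePieceFlat_eq_nil_of_le hβ D _ hi
  · exact length_pieceBF_argOf_le P s t Λ v hD j

/-- **The items generator computes the two concatenations.** For a valid drawing, with the context
of its canonical code, any `Λ ≥ 1` and translation `v`: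
`genSqItemsFn ctx = ccat (family A) ++ ccat (family B)`.
[cite: LiskiewiczOgiharaToda2003, §4 (proof of Theorem 7: R₁(x) = (E₃, …))] -/
theorem genSqItemsFn_ctx {P : List GridPoint} {D : List DrawnEdge} (hD : IsGridDrawing P D) (s t : ℕ) {Λ : ℕ}
    (hΛ : 1 ≤ Λ) (v : GridPoint) :
    genSqItemsFn (ctx (encodingDrawnGraphInstance.encode (P, D, s, t)) Λ v) =
      ccat (scaledPieceFlat (squaresK P.length) Λ D (cV v)) (scaledTotal (squaresK P.length) Λ D) ++
        ccat (squarePieceFlat (squaresK P.length) (squaresBeta P.length) D (cV v)) (squareTotal (squaresBeta P.length) D) := by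
  have hch : ∀ d ∈ D, List.IsChain IsGridEdge d.2.2 := fun d hd => (hD.2.1 d hd).2.2.2.2.2.2.1
  rw [genSqItemsFn, Function.comp_apply, fanoutFn_apply, appF_boolPair, genAFn_ctx hch s t hΛ v, genBFn_ctx hD s t Λ v]

/-- **The items generator computes the items of the code of `E₃ - σ`**: for a valid drawing, with
`Λ = maxEdges D` and the translation `-σ = -(k • img P s)` of `squaresInstance`, the output is the
items part `encList (E.map encode)` of the `Encoding.listBool` code of `E = (squaresInstance P D s t).1`
(`framesOf_squaresInstance`). [cite: LiskiewiczOgiharaToda2003, §4 (proof of Theorem 7: R₁(x) = (E₃, τ))] -/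
theorem genSqItemsFn_ctx_eq_encList {P : List GridPoint} {D : List DrawnEdge} (hD : IsGridDrawing P D) (s t : ℕ) :
    genSqItemsFn (ctx (encodingDrawnGraphInstance.encode (P, D, s, t)) (maxEdges D)
        (-((squaresK P.length : ℤ) • img P s))) =
      encList ((squaresInstance P D s t).1.map (encodingGridPoint.pairBool encodingGridPoint).encode) := by
  rw [genSqItemsFn_ctx hD s t (one_le_maxEdges D), ← frames_eq_encList]
  exact (framesOf_squaresInstance hD s t (encodingGridPoint.pairBool encodingGridPoint).encode).symm


/-! ### Sanity checks -/

/-- On the one-edge presentation of the pivot file (`N = 2`: `β = 5`, `k = 13`) the constants are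
read correctly. [folklore] -/
theorem uFacF_oneEdge (Λ : ℕ) (v : GridPoint) (i : ℕ) :
    uBetaF (argOf oneEdgeDrawing.1 oneEdgeDrawing.2 0 1 Λ v i) = ones 5 ∧
      uFacF (argOf oneEdgeDrawing.1 oneEdgeDrawing.2 0 1 Λ v i) = ones 13 := by
  rw [uBetaF_argOf, uFacF_argOf]; exact ⟨rfl, rfl⟩

/-- … and there are `1 · 1 · 13 = 13` positions of family A and `1 · 5 · 3 = 15` of family B.
[folklore] -/
theorem totals_oneEdge :
    scaledTotal (squaresK oneEdgeDrawing.1.length) (maxEdges oneEdgeDrawing.2) oneEdgeDrawing.2 = 13 ∧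
      squareTotal (squaresBeta oneEdgeDrawing.1.length) oneEdgeDrawing.2 = 15 := by
  rw [maxEdges_oneEdge]; exact ⟨rfl, rfl⟩

/-- Non-vacuity of the generator identity: on the (valid) one-edge presentation the items
generator emits the `13 + 15` framed unit edges of `E₃ - σ`. [folklore] -/
theorem genSqItemsFn_oneEdge :
    genSqItemsFn (ctx (encodingDrawnGraphInstance.encode (oneEdgeDrawing.1, oneEdgeDrawing.2, 0, 1)) (maxEdges oneEdgeDrawing.2)
        (-((squaresK oneEdgeDrawing.1.length : ℤ) • img oneEdgeDrawing.1 0))) =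
      encList ((squaresInstance oneEdgeDrawing.1 oneEdgeDrawing.2 0 1).1.map
        (encodingGridPoint.pairBool encodingGridPoint).encode) :=
  genSqItemsFn_ctx_eq_encList isGridDrawing_oneEdge 0 1


end SquaresGen

end Literature.Barriers.CriticalPhenomena.GridSAW
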